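import Literature.AnabelianGeometry.SemiGraphs.TemperedPiFibre
import Literature.AnabelianGeometry.SemiGraphs.TemperedCoveringsComponents

/-!
# Naturality of the `π₁^temp(𝒢)`-action on fibres ([SemiAnbd] Prop. 3.6 (ii), p. 38)

Sequel to `TemperedPiFibre.lean`: a morphism `φ : T ⟶ T'` of coverings maps components to
components (`CovHom.componentMap`, using `CovHom.mapPoint` of `TemperedCoveringsComponents.lean`) and commutes with the universal morphisms
`liftAt : 𝒢_{∞,n} ⟶ component` (rigidity), hence with the actions of `G_n` and of `π₁^temp(𝒢)` on
the fibres over `v₀`: `φ (γ · t) = γ · φ t` (`piAct_map`).  This is the morphism part of the functor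
`B^temp(𝒢) ⥤ B^temp(π₁^temp(𝒢))` of [SemiAnbd] Prop. 3.6 (ii) (`fibreMap`).
-/

namespace Literature.AnabelianGeometry.SemiGraphs

namespace ProfiniteSemiGraph

open CategoryTheory

universe u

variable {𝒢 : ProfiniteSemiGraph.{u}}

section ComponentMap

variable {T T' : CovObj 𝒢} (φ : T ⟶ T')

/-- The restriction of a morphism to a component. [cite: MochizukiSemiAnbd2006, Def 3.5(ii) p.37] -/
noncomputable def CovHom.componentMap (p : T.Point) :
    T.component p ⟶ T'.component (CovHom.mapPoint φ p) where
  fV v := ObjectProperty.homMk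
    { hom := TypeCat.ofHom fun x : T.CompV p v =>
        (⟨(φ.fV v).hom.hom x.1, CovHom.mapPoint_sameComponent φ x.2⟩ :
          T'.CompV (CovHom.mapPoint φ p) v)
      comm := fun g => by
        apply ConcreteCategory.hom_ext
        intro x
        apply Subtype.ext
        exact CovHom.fV_ρ φ v g x.1 }
  fE e := ObjectProperty.homMk
    { hom := TypeCat.ofHom fun y : T.CompE p e =>
        (⟨(φ.fE e).hom.hom y.1, CovHom.mapPoint_sameComponent φ y.2⟩ :
          T'.CompE (CovHom.mapPoint φ p) e)
      comm := fun g => by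
        apply ConcreteCategory.hom_ext
        intro y
        apply Subtype.ext
        exact CovHom.fE_ρ φ e g y.1 }
  comm b v h := by
    apply ObjectProperty.hom_ext
    apply Action.Hom.ext
    apply ConcreteCategory.hom_ext
    intro y
    apply Subtype.ext
    exact CovHom.glue_fE φ b v h y.1

/-- The restriction commutes with the inclusions. [cite: MochizukiSemiAnbd2006, Def 3.5(ii) p.37] -/
theorem CovHom.componentMap_ι (p : T.Point) :
    CovHom.componentMap φ p ≫ T'.componentι (CovHom.mapPoint φ p) = T.componentι p ≫ φ := by
  refine CovHom.ext (funext fun v => ?_) (funext fun e => ?_) <;> rfl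

end ComponentMap

namespace GaloisLevelData

variable (D : GaloisLevelData 𝒢) (h𝒢 : 𝒢.IsCountable) {T T' : CovObj 𝒢} (φ : T ⟶ T')

/-- The universal morphisms are natural: `liftAt_{φ t} = liftAt_t ≫ φ|component`.
[cite: MochizukiSemiAnbd2006, Prop 3.6(ii) p.38] -/
theorem liftAt_map (t : (T.SV D.v₀).obj.V) (n : ℕ)
    (hs : (D.S n).Splits (T.component (Sum.inl ⟨D.v₀, t⟩)))
    (hs' : (D.S n).Splits (T'.component (Sum.inl ⟨D.v₀, (φ.fV D.v₀).hom.hom t⟩))) :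
    D.liftAt h𝒢 T' ((φ.fV D.v₀).hom.hom t) n hs' =
      D.liftAt h𝒢 T t n hs ≫ CovHom.componentMap φ (Sum.inl ⟨D.v₀, t⟩) := by
  apply D.hom_ext_bp h𝒢 n
  rw [D.liftAt_bp]
  apply Subtype.ext
  change (φ.fV D.v₀).hom.hom t =
    (φ.fV D.v₀).hom.hom (((D.liftAt h𝒢 T t n hs).fV D.v₀).hom.hom (D.bp n)).1
  rw [D.liftAt_bp]

/-- Naturality of the level-`n` action. [cite: MochizukiSemiAnbd2006, Prop 3.6(ii) p.38] -/
theorem actAt_map (t : (T.SV D.v₀).obj.V) (n : ℕ)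
    (hs : (D.S n).Splits (T.component (Sum.inl ⟨D.v₀, t⟩)))
    (hs' : (D.S n).Splits (T'.component (Sum.inl ⟨D.v₀, (φ.fV D.v₀).hom.hom t⟩))) (σ : D.Gal h𝒢 n) :
    (φ.fV D.v₀).hom.hom (D.actAt h𝒢 T t n hs σ) =
      D.actAt h𝒢 T' ((φ.fV D.v₀).hom.hom t) n hs' σ := by
  change _ = (((D.liftAt h𝒢 T' ((φ.fV D.v₀).hom.hom t) n hs').fV D.v₀).hom.hom
    (((σ⁻¹ : D.Gal h𝒢 n).hom.fV D.v₀).hom.hom (D.bp n))).1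
  rw [D.liftAt_map h𝒢 φ t n hs hs']
  rfl

variable (lev : (T.SV D.v₀).obj.V → ℕ)
  (hlev : ∀ (t : (T.SV D.v₀).obj.V) (n : ℕ), lev t ≤ n →
    (D.S n).Splits (T.component (Sum.inl ⟨D.v₀, t⟩)))
  (lev' : (T'.SV D.v₀).obj.V → ℕ)
  (hlev' : ∀ (t : (T'.SV D.v₀).obj.V) (n : ℕ), lev' t ≤ n →
    (D.S n).Splits (T'.component (Sum.inl ⟨D.v₀, t⟩)))

/-- **Naturality of the `π₁^temp(𝒢)`-action**: `φ (γ · t) = γ · φ t`.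
[cite: MochizukiSemiAnbd2006, Prop 3.6(ii) p.38] -/
theorem piAct_map (γ : D.temperedPi h𝒢) (t : (T.SV D.v₀).obj.V) :
    (φ.fV D.v₀).hom.hom (D.piAct h𝒢 T lev hlev γ t) =
      D.piAct h𝒢 T' lev' hlev' γ ((φ.fV D.v₀).hom.hom t) := by
  have hN : lev t ≤ max (lev t) (lev' ((φ.fV D.v₀).hom.hom t)) := le_max_left _ _
  have hN' : lev' ((φ.fV D.v₀).hom.hom t) ≤ max (lev t) (lev' ((φ.fV D.v₀).hom.hom t)) :=
    le_max_right _ _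
  unfold piAct
  rw [← D.actAt_proj_eq h𝒢 T lev hlev t γ _ hN, ← D.actAt_proj_eq h𝒢 T' lev' hlev' _ γ _ hN']
  exact D.actAt_map h𝒢 φ t _ _ _ _

/-- **The functor on morphisms**: `φ ↦ φ_{v₀}` as a morphism of `B^temp(π₁^temp(𝒢))`.
[cite: MochizukiSemiAnbd2006, Prop 3.6(ii) p.38] -/
noncomputable def fibreMap : D.fibreObj h𝒢 T lev hlev ⟶ D.fibreObj h𝒢 T' lev' hlev' :=
  ObjectProperty.homMk
    { hom := TypeCat.ofHom (φ.fV D.v₀).hom.hom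
      comm := fun γ => by
        apply ConcreteCategory.hom_ext
        intro t
        exact D.piAct_map h𝒢 φ lev hlev lev' hlev' γ t }

/-- The underlying map of `fibreMap`. [cite: MochizukiSemiAnbd2006, Prop 3.6(ii) p.38] -/
theorem fibreMap_apply (t : (T.SV D.v₀).obj.V) :
    (D.fibreMap h𝒢 φ lev hlev lev' hlev').hom.hom t = (φ.fV D.v₀).hom.hom t := rfl

end GaloisLevelData

end ProfiniteSemiGraph

end Literature.AnabelianGeometry.SemiGraphs
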